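import Summits.CriticalPhenomena.PercolationContinuityZ3.Theorems.Transplant.KNCells2Reach
import Summits.CriticalPhenomena.PercolationContinuityZ3.Theorems.Transplant.KNCellsExit
import HarnessLib

/-!
# F8 (generic, LAG-1 ANCHORS), part 6 — the certificate of an occupied macro-vertex, the envelope bound and the ASSEMBLY of
# `SameP.SamePWitnessAt` for `scheme₂` (the `KNCellsExit` file for the lag-1 scheme; design HOME/prim-bschramm-p2-g2/F8-DESIGN.md §7)

builds on p205010 (kernel theorem, internal audit signed; external expert review pending) — nothing in this file uses p205010.
Lane `prim-bschramm`, seat `prim-bschramm-p2`; helper file (`--supports stmt-CriticalPhenomena-4575`).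

* `Valid₂.not_mem_Q_tgt`, **`exists_exit₂`**, **`mem_percolatesAt_of_infinite₂`**, `card_env₂_le`;
* **`samePWitnessAt_of_cells₂`** — RunGeom + AnchGeom + SepGeom₂ + ExitGeom + degree bound + envelope-region bound + `δ ≤ 1` + (32) at the
  root cell + (33) after valid histories (ε < 2⁻³²) ⟹ `SameP.SamePWitnessAt G root p`.
[cite: KozmaNitzan2024, §4 pp. 25–31 ((3), (32), proof of Theorem 6) — the ℤ^d model] [cite: GrimmettPercolation1999, §7.2]
-/

noncomputable section

open MeasureTheory ProbabilityTheory
open scoped ENNReal Classical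

namespace Summit.CriticalPhenomena.PercolationContinuityZ3.Theorems

namespace Transplant

namespace KNCells

open Literature.Probability.Percolation Literature.Probability.LatticeModels SimpleGraph GadgetSystem ProbeHistory HSiteScheme Contour

variable {V : Type*} [DecidableEq V] [Countable V]

namespace KSchA

variable {A : Type*} {G : SimpleGraph V} [G.LocallyFinite] {S : KSchA V A}
variable (hΓ : RunGeom G S.Γ) (hA : AnchGeom S.Γ) (hsep : SepGeom₂ G S.Γ) (hX : ExitGeom G S.Γ) {ω : BondConfig V}
include hΓ hA hsep hX

/-! ## §2 What an occupied macro-vertex certifies -/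

omit [Countable V] hΓ hA hsep in
/-- The explored region of a valid history misses the cube of the target (any anchor). [cite: KozmaNitzan2024, §4 p. 26 ((29))] -/
theorem Valid₂.not_mem_Q_tgt {h : ProbeHistory V} {e : Site 2 × MDir} (hV : S.Valid₂ G h e) {a : A} {y : V} (hy : y ∈ S.Vx G h) :
    y ∉ S.Γ.Q a (tgt e) := by
  obtain ⟨det, hv, -, hsub⟩ := hV.cover
  have hy' := hsub (Finset.mem_coe.2 hy)
  simp only [CellGeom.Cover, Set.mem_iUnion, Set.mem_union, exists_prop, Finset.mem_coe] at hy'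
  obtain ⟨u, hu, h' | ⟨δ, h'⟩⟩ := hy'
  · have hux : u ≠ tgt e := fun h'' => hv (h'' ▸ hu)
    exact Finset.disjoint_left.1 (hX.Cell_disjoint_Q _ _ _ _ hux) h'
  · exact Finset.disjoint_left.1 (hX.Zone_disjoint_Q _ _ _ _ _) h'

omit hsep in
/-- **The certificate of (32)** (KN p. 26, (3)): after a valid history the configuration itself has an open path inside the explored region
from the root to a `G`-neighbour of `E_{w,v}` (at the source's departure anchor) — (32) is a positive probability under the weighting pinned
on the recorded pattern, which on the initial event is the configuration's own. [cite: KozmaNitzan2024, §4 p. 26 ((3)) and p. 28 ((32))] -/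
theorem exists_exit₂ (hδc : S.δc ≤ 1) (hA' : ω ∈ initEvent (S.scheme₂ G))
    {n : ℕ} {e : Site 2 × MDir} (hV : S.Valid₂ G (S.hst₂ G ω n) e) :
    ∃ a ∈ S.Vx G (S.hst₂ G ω n), PathIn (openGraph ω) (↑(S.Vx G (S.hst₂ G ω n)) : Set V) S.Γ.root a ∧
      ∃ b ∈ S.Γ.Ewv (S.aOf₁ G (S.hst₂ G ω n) e) e.1 e.2, G.Adj a b := by
  set aa := S.aOf₁ G (S.hst₂ G ω n) e with haa
  set W := S.W₀ G (S.hst₂ G ω n) e aa with hW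
  have hI := runInv₂ hΓ hA ω n
  have hpos : 0 < (prodBernoulli W).real (⋃ t ∈ S.Γ.M aa (tgt e), openConn S.Γ.root t) :=
    lt_of_le_of_lt (by linarith) hV.reach
  -- almost surely no pair of weight zero is open
  have hae : ∀ᵐ η ∂prodBernoulli W, ∀ x ∈ {x : Sym2 V | W x = 0}, x ∉ η :=
    prodBernoulli_ae_forall_notMem _ (Set.to_countable _) fun x hx => hx
  have hne : ((⋃ t ∈ S.Γ.M aa (tgt e), openConn S.Γ.root t) ∩ {η | ∀ x : Sym2 V, W x = 0 → x ∉ η}).Nonempty := by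
    by_contra h
    rw [Set.not_nonempty_iff_eq_empty] at h
    have h1 : (prodBernoulli W).real ((⋃ t ∈ S.Γ.M aa (tgt e), openConn S.Γ.root t) ∩
        {η | ∀ x : Sym2 V, W x = 0 → x ∉ η}) = (prodBernoulli W).real (⋃ t ∈ S.Γ.M aa (tgt e), openConn S.Γ.root t) := by
      refine measureReal_congr ?_
      filter_upwards [hae] with η hη
      exact propext ⟨fun h' => h'.1, fun h' => ⟨h', fun x hx => hη x hx⟩⟩
    rw [h, measureReal_empty] at h1
    linarith
  obtain ⟨η, hηA, hη0⟩ := hne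
  simp only [Set.mem_iUnion, exists_prop] at hηA
  obtain ⟨t, ht, hreach⟩ := hηA
  have hopen : ∀ x y, (openGraph η).Adj x y → W s(x, y) ≠ 0 := fun x y hxy h0 =>
    hη0 _ h0 ((openGraph_adj _ _ _).1 hxy).1
  -- the open path from the root to `M_v` inside `E_i ∪ E_{w,v}` and its first exit from `E_i`
  have hηwire : ∀ x ∈ η, x ∈ wireSet (↑(S.Vx G (S.hst₂ G ω n) ∪ S.Γ.Ewv aa e.1 e.2) : Set V) := by
    intro x hx
    by_contra hxS
    exact hη0 x (by rw [hW, W₀]; exact restrW_apply_of_not_mem _ hxS) hx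
  have hpath := pathIn_of_reachable_of_forall_mem_wireSet hηwire
    (Finset.mem_coe.2 (Finset.mem_union_left _ hV.root_mem)) hreach
  have htV : t ∉ (↑(S.Vx G (S.hst₂ G ω n)) : Set V) := fun h =>
    Valid₂.not_mem_Q_tgt hX hV (Finset.mem_coe.1 h) (hX.M_subset_Q _ _ ht)
  obtain ⟨a, b, ha, hb, hbU, hab, hpa⟩ := hpath.exit (R := (↑(S.Vx G (S.hst₂ G ω n)) : Set V))
    (Finset.mem_coe.2 hV.root_mem) htV
  have hbE : b ∈ S.Γ.Ewv aa e.1 e.2 := by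
    rcases Finset.mem_union.1 (Finset.mem_coe.1 hbU) with h | h
    · exact absurd (Finset.mem_coe.2 h) hb
    · exact h
  have haU : a ∈ (↑(S.Vx G (S.hst₂ G ω n) ∪ S.Γ.Ewv aa e.1 e.2) : Set V) :=
    Finset.mem_coe.2 (Finset.mem_union_left _ (Finset.mem_coe.1 ha))
  -- the exit edge is an edge of `G`
  have hab' : G.Adj a b := by
    have h1 := hopen a b hab
    rw [hW, W₀, restrW_apply_of_mem _ (mk_mem_wireSet_iff.2 ⟨haU, hbU, hab.ne⟩)] at h1
    have hF : s(a, b) ∉ (↑(S.F G (S.hst₂ G ω n)) : Set (Sym2 V)) := by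
      intro h
      rw [Finset.mem_coe, hI.F_eq, mem_edgesIn_iff] at h
      exact hb (Finset.mem_coe.2 (h.2 b (Sym2.mem_mk_right _ _)))
    rw [pinW_apply_of_not_mem _ _ hF] at h1
    by_contra hnadj
    exact h1 (KNLevels.lattW_mk_of_not_adj G S.p hnadj)
  -- the initial segment is `ω`-open
  have hpa' : PathIn (openGraph ω) (↑(S.Vx G (S.hst₂ G ω n)) : Set V) S.Γ.root a := by
    refine (DCT16.pathIn_congrGraph (fun x y hx hy hxy => ?_) hpa).mono Set.inter_subset_left
    have hxV : x ∈ S.Vx G (S.hst₂ G ω n) := Finset.mem_coe.1 hx.1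
    have hyV : y ∈ S.Vx G (S.hst₂ G ω n) := Finset.mem_coe.1 hy.1
    have h1 := hopen x y hxy
    have hne := hxy.ne
    rw [hW, W₀, restrW_apply_of_mem _ (mk_mem_wireSet_iff.2 ⟨hx.2, hy.2, hne⟩)] at h1
    by_cases hF : s(x, y) ∈ (↑(S.F G (S.hst₂ G ω n)) : Set (Sym2 V))
    · have hξ : s(x, y) ∈ (↑(S.ξ G (S.hst₂ G ω n)) : Set (Sym2 V)) := by
        by_contra hξ
        rw [pinW_apply_of_mem_of_not_mem _ hF hξ] at h1
        exact h1 rfl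
      rw [openGraph_adj]
      rcases ((hI.ξ_iff _).1 (Finset.mem_coe.1 hξ)).2 with h | h
      · exact ⟨h, hne⟩
      · exact ⟨hA' (Finset.mem_coe.2 h), hne⟩
    · exfalso
      rw [pinW_apply_of_not_mem _ _ hF] at h1
      by_cases hadj : G.Adj x y
      · apply hF
        rw [Finset.mem_coe, hI.F_eq, mem_edgesIn_iff]
        refine ⟨(SimpleGraph.mem_edgeSet _).2 hadj, fun z hz => ?_⟩
        rcases Sym2.mem_iff.1 hz with rfl | rfl
        · exact hxV
        · exact hyV
      · exact h1 (KNLevels.lattW_mk_of_not_adj G S.p hadj)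
  exact ⟨a, Finset.mem_coe.1 ha, hpa', b, hbE, hab'⟩

omit hsep in
/-- **An infinite macro-cluster forces an infinite open cluster of the root** (KN pp. 26–27: "the combination of (2) and (3)"): every
occupied macro-vertex `v ≠ 0` was examined after a valid history, whose certificate is a vertex of the root's cluster adjacent to the edge
region `E_{w,v}`; a vertex is adjacent to the edge regions of boundedly many macro-targets. [cite: KozmaNitzan2024, §4 pp. 26–27] -/
theorem mem_percolatesAt_of_infinite₂ (hδc : S.δc ≤ 1) (hA' : ω ∈ initEvent (S.scheme₂ G))
    (hinf : ((S.scheme₂ G).occFinal ω).Infinite) : ω ∈ percolatesAt S.Γ.root := by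
  set Cl := openCluster ω S.Γ.root with hCl
  have hnear : ∀ v ∈ (S.scheme₂ G).occFinal ω, v ≠ 0 →
      ∃ y ∈ Cl, v ∈ {v : Site 2 | ∃ (a : A) (w : Site 2) (δ : MDir), w + stepVec δ = v ∧ ∃ b ∈ S.Γ.Ewv a w δ, G.Adj y b} := by
    intro v hv hv0
    obtain ⟨n, hvn⟩ := Set.mem_iUnion.1 hv
    rcases (S.scheme₂ G).exists_probe_of_det ω n v (Or.inl hvn) with h | ⟨m, -, e, P, hc, hte, hP, -⟩
    · exact absurd h hv0
    obtain ⟨e', hc', hV, rfl⟩ := S.of_next_some₂ hP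
    rw [hc] at hc'
    cases Option.some_injective _ hc'
    obtain ⟨y, -, hpa, b, hb, hyb⟩ := exists_exit₂ hΓ hA hX hδc hA' hV
    refine ⟨y, DCT16.reachable_of_pathIn hpa, ?_⟩
    exact ⟨S.aOf₁ G (S.hst₂ G ω m) e, e.1, e.2, hte, b, hb, hyb⟩
  by_contra hfin
  have hClfin : Cl.Finite := Set.not_infinite.1 hfin
  have hF : (⋃ y ∈ Cl, {v : Site 2 | ∃ (a : A) (w : Site 2) (δ : MDir), w + stepVec δ = v ∧ ∃ b ∈ S.Γ.Ewv a w δ, G.Adj y b}).Finite :=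
    hClfin.biUnion fun y _ => hX.locFin y
  refine hinf ((hF.union (Set.finite_singleton 0)).subset fun v hv => ?_)
  by_cases hv0 : v = 0
  · exact Or.inr hv0
  · obtain ⟨y, hy, hnr⟩ := hnear v hv hv0
    exact Or.inl (Set.mem_biUnion hy hnr)

/-! ## §3 The envelope bound -/

omit [Countable V] hΓ hA hsep hX in
/-- **After a valid history the envelope of the examination has at most `Δ · B` edges** (`B` a bound on the envelope regions).
[cite: KozmaNitzan2024, §4 p. 27 (E_{i+1})] -/
theorem card_env₂_le {Δ B : ℕ} (hΔ : ∀ x, G.degree x ≤ Δ)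
    (hB : ∀ (h : ProbeHistory V) (e : Site 2 × MDir) (a a' : A), (S.envRegion₂ G h e a a').card ≤ B)
    {h : ProbeHistory V} {e : Site 2 × MDir} (hV : S.Valid₂ G h e) (a a' : A) :
    (S.env₂ G h e a a').card ≤ Δ * B := by
  have hsub : S.env₂ G h e a a' ⊆ edgesTouching G (S.envRegion₂ G h e a a') := by
    intro x hx
    rw [KSchA.env₂, Finset.mem_sdiff, hV.F_eq] at hx
    obtain ⟨hx1, hx2⟩ := hx
    rw [mem_edgesIn_iff] at hx1 hx2
    rw [mem_edgesTouching_iff]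
    refine ⟨hx1.1, ?_⟩
    by_contra hcon
    push Not at hcon
    exact hx2 ⟨hx1.1, fun z hz => (Finset.mem_union.1 (hx1.2 z hz)).resolve_right fun hzR => hcon z hzR hz⟩
  calc (S.env₂ G h e a a').card ≤ (edgesTouching G (S.envRegion₂ G h e a a')).card := Finset.card_le_card hsub
    _ ≤ ∑ x ∈ S.envRegion₂ G h e a a', (G.incidenceFinset x).card := Finset.card_biUnion_le
    _ ≤ ∑ _x ∈ S.envRegion₂ G h e a a', Δ := Finset.sum_le_sum fun x _ => by
        rw [SimpleGraph.card_incidenceFinset_eq_degree]; exact hΔ x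
    _ = Δ * (S.envRegion₂ G h e a a').card := by rw [Finset.sum_const, smul_eq_mul, mul_comm]
    _ ≤ Δ * B := Nat.mul_le_mul_left _ (hB h e a a')

/-! ## §4 The assembly: the five conjuncts of `SameP.SamePWitnessAt` -/

/-- **THE LAG-1 ANCHORED EXPLORATION PROCESS IS A SAME-`p` WITNESS**: given an anchored cell geometry of `G` with the run / anchor /
separation / exit facts, a degree bound `Δ`, an envelope-region bound `B`, threshold `δ ≤ 1`, (32) at the root cell (`hQ0`) and the failure
bound (33) after valid histories with `ε < 2⁻³²` (`hfail`: both anchors read from the history — KN's Step IV verbatim, see `KNCells2Fail`), the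
scheme `scheme₂` is a lawful history-driven site-renormalisation scheme with bounded envelopes, `U₀ ⊆ E(G)`, whose infinite macro-cluster forces
`root ↔ ∞` — i.e. `SameP.SamePWitnessAt G root p`. [cite: KozmaNitzan2024, §4 Theorem 6 (pp. 25–31)] -/
theorem samePWitnessAt_of_cells₂ {Δ B : ℕ} (hΔ : ∀ x, G.degree x ≤ Δ)
    (hB : ∀ (h : ProbeHistory V) (e : Site 2 × MDir) (a a' : A), (S.envRegion₂ G h e a a').card ≤ B)
    (hδc : S.δc ≤ 1) {ε : ℝ} (hε : ε < (1 / 2) ^ 32)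
    (hQ0 : ∀ du : MDir, 1 - S.δc < (prodBernoulli (pinW (KNLevels.lattW G S.p) ↑(S.U₀ G) ↑(S.U₀ G))).real
      (⋃ t ∈ (↑(S.Γ.M S.Γ.a₀ ((0 : Site 2) + stepVec du)) : Set V),
        openConnIn (↑(S.Γ.Q S.Γ.a₀ 0 ∪ S.Γ.Ewv S.Γ.a₀ 0 du) : Set V) S.Γ.root t))
    (hfail : ∀ h e, S.Valid₂ G h e →
      (bondPercolation G S.p).real
        {ω | ¬S.succ₂ G h e (S.aOf₁ G h e) (S.aOf₂ G h e) ((S.probe₂ G h e (S.aOf₁ G h e) (S.aOf₂ G h e)).read ω)} ≤ ε) :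
    SameP.SamePWitnessAt G S.Γ.root S.p := by
  refine ⟨S.scheme₂ G, ε, Δ * B, lawful₂ hΓ hA hsep hQ0 hfail, hε, ?_, fun x hx => (mem_edgesIn_iff.1 (Finset.mem_coe.1 hx)).1, ?_⟩
  · intro hh P hP
    rw [KSchA.scheme₂_next] at hP
    obtain ⟨e, -, hV, rfl⟩ := S.nextProbe₂_eq_some hP
    exact card_env₂_le hΔ hB hV _ _
  · rintro ω' ⟨hA', hinf⟩
    exact Or.inl (mem_percolatesAt_of_infinite₂ hΓ hA hX (ω := ω') hδc hA' hinf)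

end KSchA

end KNCells

end Transplant

end Summit.CriticalPhenomena.PercolationContinuityZ3.Theorems

end
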